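import Summits.CriticalPhenomena.PercolationContinuityZ3.Theorems.Transplant.SkelPhiParaCoarseV
import Summits.CriticalPhenomena.PercolationContinuityZ3.Theorems.Transplant.TwoAxisParaCellsFine
import Summits.CriticalPhenomena.PercolationContinuityZ3.Theorems.Transplant.TwoAxisParaCellsRun
import HarnessLib

/-!
# N1 (the `{±1}` node), LEVEL 1, (C) column file (C-N8): THE SIGNED v-ROUNDS OVER THE FINE CELL MAP — phase 1 of the (C) corridor: a localisation record
# `P₁ : ChainPara.LocPrm` along the cell axis `1` (`ρ_v`) about the cell centre `c`, run as the schedule **`P₁.scheduleNz 1 c hP₁ z`** (= `scheduleN` with the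
# SMALLER enlargement `R' := e − z`, so that a seed sits `z` inside the `e`-enlarged core — the floor slack of the readings), read through hp-8's fine map
# `fineSkel φ t₀ A n h vα vβ c₀' c₁' s₀ s₁ D` with the stride sign PER WALKER `σ_w = dir (ρ₁(t) − c₁)` and the top piece `τ_w = steerT σ_w (ρ₀(t) − c₀)`; the two
# LEVEL-1 facts the route datum consumes: **`fine_mem_vlocRegion_of_link`** (`w ∈ pgramPrism t n h (3ℓ) R ⇒ ρ(w) ∈ region k`, hp-8's coarse containment per
# axis) and **`fine_mem_vlocCore_succ_of_piece`** (`w ∈ pgTopPieceW t n h ℓ R σ_w τ_w v ⇒ ρ(w) ∈ core (k+1)`: the signed readings `coarse_landing_v_one/_neg` of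
# (C-N3) + its TOLERANT landing `inCore_succ_of_landing_tol`), under TEN numeric hypotheses relating the record's `sLo sHi Pp Pm` and the slack `z` to the
# reading numerators (discharged by the params column from the NEG-PARAMS floors).

builds on p205010 (kernel theorem, internal audit signed; external expert review pending) — nothing in this file uses p205010; nothing here is a
claim about the open node `SamePDropOfSkeletonNeg`.
Lane `prim-bschramm`, seat `prim-bschramm-p5` (gen 8; (C) lineage; C-FUNNEL.md §2 phase 1); helper file (`--supports stmt-CriticalPhenomena-4575`).
[cite: KozmaNitzan2024, §4 Lemma 11 (pp. 22–23), Lemma 12 (pp. 23–25)] [cite: MartineauTassion2017, §4.3 Lemma 4.2]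
-/

noncomputable section

namespace Summit.CriticalPhenomena.PercolationContinuityZ3.Theorems.Transplant

open Literature.Probability.Percolation Literature.Probability.LatticeModels SimpleGraph
open Literature.Probability.Percolation.KozmaNitzan.Cells (oth)
open TwoAxis.Para (coarse lam0 lam1 modulus)
open ChainPlanar

/-! ## §1 The localisation schedule with a smaller enlargement -/

namespace ChainPara

/-- Shrinking the enlargement radius shrinks the enlarged box. [folklore] -/
theorem Icc_enlarge_mono (lo hi : Site 2) {R₁ R₂ : ℕ} (h : R₁ ≤ R₂) :
    Finset.Icc (lo - ((R₁ : ℕ) : Site 2)) (hi + ((R₁ : ℕ) : Site 2)) ⊆ Finset.Icc (lo - ((R₂ : ℕ) : Site 2)) (hi + ((R₂ : ℕ) : Site 2)) := by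
  have h' : (R₁ : ℤ) ≤ R₂ := by exact_mod_cast h
  refine Finset.Icc_subset_Icc ?_ ?_
  · intro j; simp only [Pi.sub_apply, Pi.natCast_apply]; linarith
  · intro j; simp only [Pi.add_apply, Pi.natCast_apply]; linarith

namespace LocPrm

/-- **The localisation rounds with enlargement `e − z`** (`z` = the floor slack of the readings): the schedule `scheduleN` with `R' := e − z`; cores,
regions, prism and step parameters unchanged. [cite: KozmaNitzan2024, §4 Lemma 12 (pp. 23–25)] -/
def scheduleNz (P : LocPrm) (a : Fin 2) (c : Site 2) (hP : LocOK P) (z : ℕ) : ScheduleN :=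
  { P.scheduleN a c hP with
    R' := P.e - z
    encl := fun k hk => (Icc_enlarge_mono _ _ (Nat.sub_le P.e z)).trans ((P.scheduleN a c hP).encl k hk)
    route := fun k hk v hv => (P.scheduleN a c hP).route k hk v (Icc_enlarge_mono _ _ (Nat.sub_le P.e z) hv) }

section API

variable (P : LocPrm) (a : Fin 2) (c : Site 2) (hP : LocOK P) (z : ℕ)

/-- The cores of `scheduleNz`. [folklore] -/
@[simp] theorem scheduleNz_core (k : ℕ) : (P.scheduleNz a c hP z).core k = P.pcore a c k := rfl

/-- The regions of `scheduleNz`. [folklore] -/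
@[simp] theorem scheduleNz_region (k : ℕ) : (P.scheduleNz a c hP z).region k = P.pregion a c k := rfl

/-- The prism of `scheduleNz`. [folklore] -/
@[simp] theorem scheduleNz_prism : (P.scheduleNz a c hP z).prism = P.pprism a c := rfl

/-- The parameters of `scheduleNz`: `N`, `R' = e − z`, axis `a`, strides `[sLo, sHi]`, drift `0`, pieces `Pp`/`Pm`, link box `La`/`Lb`. [folklore] -/
theorem scheduleNz_params : (P.scheduleNz a c hP z).N = P.N ∧ (P.scheduleNz a c hP z).R' = P.e - z ∧ (∀ k, (P.scheduleNz a c hP z).ax k = a) ∧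
    (∀ k, (P.scheduleNz a c hP z).sLo k = P.sLo) ∧ (∀ k, (P.scheduleNz a c hP z).sHi k = P.sHi) ∧ (∀ k, (P.scheduleNz a c hP z).d k = 0) ∧
    (∀ k, (P.scheduleNz a c hP z).Pp k = P.Pp) ∧ (∀ k, (P.scheduleNz a c hP z).Pm k = P.Pm) ∧
    (∀ k, (P.scheduleNz a c hP z).La k = P.La) ∧ (∀ k, (P.scheduleNz a c hP z).Lb k = P.Lb) :=
  ⟨rfl, rfl, fun _ => rfl, fun _ => rfl, fun _ => rfl, fun _ => rfl, fun _ => rfl, fun _ => rfl, fun _ => rfl, fun _ => rfl⟩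

/-- Membership in the `(e − z)`-enlarged core `k` of `scheduleNz` (`z ≤ e`): offsets `|y_a − c_a| ≤ L k + e − z`, `|y_{a′} − c_{a′}| ≤ W + k·e + e − z`. [folklore] -/
theorem mem_scheduleNz_enl_iff (hz : z ≤ P.e) {k : ℕ} {y : Site 2} :
    y ∈ Finset.Icc ((P.scheduleNz a c hP z).lo k - (((P.scheduleNz a c hP z).R' : ℕ) : Site 2))
        ((P.scheduleNz a c hP z).hi k + (((P.scheduleNz a c hP z).R' : ℕ) : Site 2)) ↔
      |y a - c a| ≤ P.L k + P.e - z ∧ |y (oth a) - c (oth a)| ≤ P.Wk k + P.e - z := by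
  show y ∈ Finset.Icc (dLo a 1 c (-P.L k) (P.L k) (-P.Wk k) (P.Wk k) - (((P.e - z : ℕ) : ℕ) : Site 2))
      (dHi a 1 c (-P.L k) (P.L k) (-P.Wk k) (P.Wk k) + (((P.e - z : ℕ) : ℕ) : Site 2)) ↔ _
  rw [dBox_enlarge (Or.inl rfl), mem_dBox_iff (Or.inl rfl)]
  simp only [one_mul, abs_le, Nat.cast_sub hz]
  constructor
  · rintro ⟨⟨h1, h2⟩, h3, h4⟩; exact ⟨⟨by linarith, by linarith⟩, by linarith, by linarith⟩
  · rintro ⟨⟨h1, h2⟩, h3, h4⟩; exact ⟨⟨by linarith, by linarith⟩, by linarith, by linarith⟩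

end API

end LocPrm

end ChainPara

open ChainPara

namespace Skelφ

variable {V : Type} {G : SimpleGraph V} {φ : V → Site 2}

/-- `oth 1 = 0` on `Fin 2`. [folklore] -/
private theorem oth_one' : oth (1 : Fin 2) = 0 := by decide

section VRounds

variable {t₀ : V} {A : ℤ} {n : ℕ} {h vα vβ c₀' c₁' s₀ s₁ D : ℤ} {ℓ : ℕ} (P₁ : LocPrm) (hP₁ : LocOK P₁) (c : Site 2) (z : ℕ)

/-- **The link region of a seed in the enlarged core is read into the region** (v-rounds over the fine map, schedule `P₁.scheduleNz 1 c hP₁ z`):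
`|Δα| ≤ n`, `|Δβ′| ≤ 3nℓ` give `|Δρ₁| ≤ La`, `|Δρ₀| ≤ Lb` under `c₁'·|A|·3nℓ ≤ La·D` and `c₀'·|A|·(|m|·n + |vα|·3nℓ) ≤ Lb·(n·D)`.
[cite: KozmaNitzan2024, §4 Lemma 11 (p. 22)] -/
theorem fine_mem_vlocRegion_of_link (hz : z ≤ P₁.e) (hn : 1 ≤ n) (hc₀ : 0 ≤ c₀') (hc₁ : 0 ≤ c₁') (hD : 0 < D)
    (hLa : c₁' * (|A| * (3 * ((n : ℤ) * ℓ))) ≤ (P₁.La : ℤ) * D)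
    (hLb : c₀' * (|A| * (|modulus n h vα vβ| * n + |vα| * (3 * ((n : ℤ) * ℓ)))) ≤ (P₁.Lb : ℤ) * ((n : ℤ) * D))
    {k : ℕ} {t w : V} {R : ℕ}
    (ht : fineSkel φ t₀ A n h vα vβ c₀' c₁' s₀ s₁ D t ∈
      Finset.Icc ((P₁.scheduleNz 1 c hP₁ z).lo k - (((P₁.scheduleNz 1 c hP₁ z).R' : ℕ) : Site 2))
        ((P₁.scheduleNz 1 c hP₁ z).hi k + (((P₁.scheduleNz 1 c hP₁ z).R' : ℕ) : Site 2)))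
    (hw : w ∈ pgramPrism G φ t n h (3 * ℓ) R) :
    fineSkel φ t₀ A n h vα vβ c₀' c₁' s₀ s₁ D w ∈ (P₁.scheduleNz 1 c hP₁ z).region k := by
  have ht' := (LocPrm.mem_scheduleNz_enl_iff P₁ 1 c hP₁ z hz).1 ht
  rw [oth_one'] at ht'
  have htE : P₁.InEnl k (fineSkel φ t₀ A n h vα vβ c₀' c₁' s₀ s₁ D t 1 - c 1) (fineSkel φ t₀ A n h vα vβ c₀' c₁' s₀ s₁ D t 0 - c 0) :=
    ⟨ht'.1.trans (by linarith [Int.natCast_nonneg z]), ht'.2.trans (by linarith [Int.natCast_nonneg z])⟩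
  obtain ⟨-, hC⟩ := (mem_pgramPrism G φ).1 hw
  obtain ⟨hα, hβ⟩ := (mem_pgramCyl (φ := φ)).1 hC
  -- run offsets of `w` relative to `t`, as base-`t₀` differences
  have hα' : |relCoord φ t₀ 0 w - relCoord φ t₀ 0 t| ≤ n := by
    have : relCoord φ t₀ 0 w - relCoord φ t₀ 0 t = relCoord φ t 0 w := by simp only [relCoord_apply]; ring
    rw [this]; exact hα
  have hβ' : |shearCoord φ t₀ n h w - shearCoord φ t₀ n h t| ≤ 3 * ((n : ℤ) * ℓ) := by
    have : shearCoord φ t₀ n h w - shearCoord φ t₀ n h t = shearCoord φ t n h w := by simp only [shearCoord_apply]; ring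
    rw [this]
    calc |shearCoord φ t n h w| ≤ (n : ℤ) * ((3 * ℓ : ℕ) : ℤ) := hβ
      _ = 3 * ((n : ℤ) * ℓ) := by push_cast; ring
  have hn0 : 0 < n := hn
  have h1n : (1 : ℤ) ≤ n := by exact_mod_cast hn
  -- coordinate 1 at `c₁'`, coordinate 0 at `c₀'`
  have h1 : |fineSkel φ t₀ A n h vα vβ c₀' c₁' s₀ s₁ D w 1 - fineSkel φ t₀ A n h vα vβ c₀' c₁' s₀ s₁ D t 1| ≤ P₁.La := by
    rw [fineSkel_apply_one, fineSkel_apply_one]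
    exact (coarse_containment_run (φ := φ) (s₀ := s₀) (s₁ := s₁) t₀ hn0 hc₁ hD
      (k₀ := c₁' * (|A| * (|modulus n h vα vβ| * n + |vα| * (3 * ((n : ℤ) * ℓ)))))
      (by have h0 : 0 ≤ c₁' * (|A| * (|modulus n h vα vβ| * (n : ℤ) + |vα| * (3 * ((n : ℤ) * ℓ)))) := by positivity
          have hD1 : 1 ≤ (n : ℤ) * D := by nlinarith
          nlinarith) hLa hα' hβ').2
  have h0 : |fineSkel φ t₀ A n h vα vβ c₀' c₁' s₀ s₁ D w 0 - fineSkel φ t₀ A n h vα vβ c₀' c₁' s₀ s₁ D t 0| ≤ P₁.Lb := by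
    rw [fineSkel_apply_zero, fineSkel_apply_zero]
    exact (coarse_containment_run (φ := φ) (s₀ := s₀) (s₁ := s₁) t₀ hn0 hc₀ hD hLb (k₁ := c₀' * (|A| * (3 * ((n : ℤ) * ℓ))))
      (by have h0 : 0 ≤ c₀' * (|A| * (3 * ((n : ℤ) * ℓ))) := by positivity
          nlinarith) hα' hβ').1
  rw [LocPrm.scheduleNz_region, LocPrm.mem_pregion_iff, oth_one']
  refine LocPrm.inRegion_of_link htE ?_ ?_
  · have e : fineSkel φ t₀ A n h vα vβ c₀' c₁' s₀ s₁ D w 1 - c 1 - (fineSkel φ t₀ A n h vα vβ c₀' c₁' s₀ s₁ D t 1 - c 1) =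
        fineSkel φ t₀ A n h vα vβ c₀' c₁' s₀ s₁ D w 1 - fineSkel φ t₀ A n h vα vβ c₀' c₁' s₀ s₁ D t 1 := by ring
    rw [e]; exact h1
  · have e : fineSkel φ t₀ A n h vα vβ c₀' c₁' s₀ s₁ D w 0 - c 0 - (fineSkel φ t₀ A n h vα vβ c₀' c₁' s₀ s₁ D t 0 - c 0) =
        fineSkel φ t₀ A n h vα vβ c₀' c₁' s₀ s₁ D w 0 - fineSkel φ t₀ A n h vα vβ c₀' c₁' s₀ s₁ D t 0 := by ring
    rw [e]; exact h0

variable [G.LocallyFinite]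

/-- **A steered top piece from a seed in the `(e − z)`-enlarged core is read into the next core** (v-rounds over the fine map): the walker's stride sign is
`σ_w := dir (ρ₁(t) − c₁)` (towards the centre line), its piece `τ_w := steerT σ_w (ρ₀(t) − c₀)`; the signed readings of `coarse_landing_v_one` (`σ_w = 1`)
/ `coarse_landing_v_neg` (`σ_w = −1`) put `σ_w·Δρ₁ ∈ [sLo, sHi]` and `σ_w·Δρ₀` in the TOLERANT piece, and `inCore_succ_of_landing_tol` lands it. The ten
numeric hypotheses (`b₁ = nℓ − c_u + 1`, `b₂ = nℓ`, `m = modulus n h vα vβ`): along `sLo + 1 ≤ ⌊c₁'Ab₁/D⌋`, `⌊c₁'Ab₂/D⌋ + 1 ≤ sHi`; transverse, frame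
sign `+1`: `U⁺ + 1 ≤ Pp`, `−z ≤ L⁺`, `−Pm ≤ L⁻`, `U⁻ + 1 ≤ z`; frame sign `−1`: `Ū⁺ + 1 ≤ z`, `−Pp ≤ L̄⁺`, `Ū⁻ + 1 ≤ Pm`, `−z ≤ L̄⁻` (the eight
numerators of (C-N3), verbatim). [cite: KozmaNitzan2024, §4 Lemma 12 (pp. 23–25)] [cite: MartineauTassion2017, §4.3 Lemma 4.2] -/
theorem fine_mem_vlocCore_succ_of_piece (hz : z ≤ P₁.e) (hA : 0 ≤ A) (hn : 1 ≤ n) (hm : 0 ≤ modulus n h vα vβ) (hc₀ : 0 ≤ c₀') (hc₁ : 0 ≤ c₁')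
    (hD : 0 < D) (hzP : (P₁.Pp : ℤ) + z ≤ P₁.W) (hzM : (P₁.Pm : ℤ) + z ≤ P₁.W) {v : ℤ}
    -- along
    (hsLo : P₁.sLo + 1 ≤ (c₁' * (A * ((n : ℤ) * ℓ - (n + h.natAbs : ℕ) + 1))) / D)
    (hsHi : (c₁' * (A * ((n : ℤ) * ℓ))) / D + 1 ≤ P₁.sHi)
    -- transverse, frame sign `+1`
    (hp₁ : (c₀' * (A * (modulus n h vα vβ * n - min (vα * ((n : ℤ) * ℓ - (n + h.natAbs : ℕ) + 1)) (vα * ((n : ℤ) * ℓ))) / n)) / D + 1 ≤ P₁.Pp)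
    (hz₁ : -(z : ℤ) ≤ (c₀' * (A * (modulus n h vα vβ * v - max (vα * ((n : ℤ) * ℓ - (n + h.natAbs : ℕ) + 1)) (vα * ((n : ℤ) * ℓ))) / n)) / D)
    (hm₁ : -(P₁.Pm : ℤ) ≤ (c₀' * (A * (modulus n h vα vβ * (-(n : ℤ)) - max (vα * ((n : ℤ) * ℓ - (n + h.natAbs : ℕ) + 1)) (vα * ((n : ℤ) * ℓ))) / n)) / D)
    (hz₂ : (c₀' * (A * (modulus n h vα vβ * v - min (vα * ((n : ℤ) * ℓ - (n + h.natAbs : ℕ) + 1)) (vα * ((n : ℤ) * ℓ))) / n)) / D + 1 ≤ z)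
    -- transverse, frame sign `−1`
    (hz₃ : (c₀' * (A * (modulus n h vα vβ * (-v) - min (vα * (-((n : ℤ) * ℓ))) (vα * (-((n : ℤ) * ℓ - (n + h.natAbs : ℕ) + 1)))) / n)) / D + 1 ≤ z)
    (hp₂ : -(P₁.Pp : ℤ) ≤ (c₀' * (A * (modulus n h vα vβ * (-(n : ℤ)) - max (vα * (-((n : ℤ) * ℓ))) (vα * (-((n : ℤ) * ℓ - (n + h.natAbs : ℕ) + 1)))) / n)) / D)
    (hm₂ : (c₀' * (A * (modulus n h vα vβ * n - min (vα * (-((n : ℤ) * ℓ))) (vα * (-((n : ℤ) * ℓ - (n + h.natAbs : ℕ) + 1)))) / n)) / D + 1 ≤ P₁.Pm)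
    (hz₄ : -(z : ℤ) ≤ (c₀' * (A * (modulus n h vα vβ * (-v) - max (vα * (-((n : ℤ) * ℓ))) (vα * (-((n : ℤ) * ℓ - (n + h.natAbs : ℕ) + 1)))) / n)) / D)
    {k : ℕ} {t w : V} {R : ℕ}
    (ht : fineSkel φ t₀ A n h vα vβ c₀' c₁' s₀ s₁ D t ∈
      Finset.Icc ((P₁.scheduleNz 1 c hP₁ z).lo k - (((P₁.scheduleNz 1 c hP₁ z).R' : ℕ) : Site 2))
        ((P₁.scheduleNz 1 c hP₁ z).hi k + (((P₁.scheduleNz 1 c hP₁ z).R' : ℕ) : Site 2)))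
    (hw : w ∈ pgTopPieceW G φ t n h ℓ R (LocPrm.dir (fineSkel φ t₀ A n h vα vβ c₀' c₁' s₀ s₁ D t 1 - c 1))
      (LocPrm.steerT (LocPrm.dir (fineSkel φ t₀ A n h vα vβ c₀' c₁' s₀ s₁ D t 1 - c 1)) (fineSkel φ t₀ A n h vα vβ c₀' c₁' s₀ s₁ D t 0 - c 0)) v) :
    fineSkel φ t₀ A n h vα vβ c₀' c₁' s₀ s₁ D w ∈ (P₁.scheduleNz 1 c hP₁ z).core (k + 1) := by
  have ht' := (LocPrm.mem_scheduleNz_enl_iff P₁ 1 c hP₁ z hz).1 ht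
  rw [oth_one'] at ht'
  set F := fineSkel φ t₀ A n h vα vβ c₀' c₁' s₀ s₁ D with hF
  set a := F t 1 - c 1 with ha_def
  set b := F t 0 - c 0 with hb_def
  have hz0 : (0 : ℤ) ≤ z := Int.natCast_nonneg z
  rw [LocPrm.scheduleNz_core, LocPrm.mem_pcore_iff, oth_one']
  have cv1 : ∀ w', coarseSkel φ t₀ A n h vα vβ c₁' s₀ s₁ D w' 1 = F w' 1 := fun _ => rfl
  have cv0 : ∀ w', coarseSkel φ t₀ A n h vα vβ c₀' s₀ s₁ D w' 0 = F w' 0 := fun _ => rfl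
  have e1 : F w 1 - c 1 - a = F w 1 - F t 1 := by rw [ha_def]; ring
  have e0 : F w 0 - c 0 - b = F w 0 - F t 0 := by rw [hb_def]; ring
  refine LocPrm.inCore_succ_of_landing_tol hz0 hzP hzM (a := a) (b := b) (ht'.1.trans (by linarith)) ht'.2 ?_ ?_ ?_ ?_
  · -- sLo ≤ dir a · Δρ₁
    rw [e1]
    rcases LocPrm.dir_eq_or a with hd | hd <;> rw [hd] at hw ⊢
    · have hr := (coarse_landing_v_one (φ := φ) (t₀ := t₀) (vα := vα) (vβ := vβ) (c := c₁') (s₀ := s₀) (s₁ := s₁) hA hn hm hc₁ hD hw).1.1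
      rw [cv1, cv1] at hr; rw [one_mul]; linarith
    · have hr := (coarse_landing_v_neg (φ := φ) (t₀ := t₀) (vα := vα) (vβ := vβ) (c := c₁') (s₀ := s₀) (s₁ := s₁) hA hn hm hc₁ hD hw).1.2
      have e : c₁' * (A * (-((n : ℤ) * ℓ - (n + h.natAbs : ℕ) + 1))) = -(c₁' * (A * ((n : ℤ) * ℓ - (n + h.natAbs : ℕ) + 1))) := by ring
      rw [e, cv1, cv1] at hr
      have hb := (neg_ediv_neg_bounds (c₁' * (A * ((n : ℤ) * ℓ - (n + h.natAbs : ℕ) + 1))) hD).1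
      change P₁.sLo ≤ -1 * (F w 1 - F t 1)
      linarith
  · -- dir a · Δρ₁ ≤ sHi
    rw [e1]
    rcases LocPrm.dir_eq_or a with hd | hd <;> rw [hd] at hw ⊢
    · have hr := (coarse_landing_v_one (φ := φ) (t₀ := t₀) (vα := vα) (vβ := vβ) (c := c₁') (s₀ := s₀) (s₁ := s₁) hA hn hm hc₁ hD hw).1.2
      rw [cv1, cv1] at hr; rw [one_mul]; linarith
    · have hr := (coarse_landing_v_neg (φ := φ) (t₀ := t₀) (vα := vα) (vβ := vβ) (c := c₁') (s₀ := s₀) (s₁ := s₁) hA hn hm hc₁ hD hw).1.1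
      have e : c₁' * (A * (-((n : ℤ) * ℓ))) = -(c₁' * (A * ((n : ℤ) * ℓ))) := by ring
      rw [e, cv1, cv1] at hr
      have hb := (neg_ediv_neg_bounds (c₁' * (A * ((n : ℤ) * ℓ))) hD).2
      change -1 * (F w 1 - F t 1) ≤ P₁.sHi
      linarith
  · -- piece `+1`
    intro hτ
    rw [e0]
    rcases LocPrm.dir_eq_or a with hd | hd <;> rw [hd] at hw hτ ⊢
    · rw [hτ] at hw
      have hr := (coarse_landing_v_one (φ := φ) (t₀ := t₀) (vα := vα) (vβ := vβ) (c := c₀') (s₀ := s₀) (s₁ := s₁) hA hn hm hc₀ hD hw).2.1 rfl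
      rw [cv0, cv0] at hr; rw [one_mul]; exact ⟨hz₁.trans hr.1, hr.2.trans hp₁⟩
    · rw [hτ] at hw
      have hr := (coarse_landing_v_neg (φ := φ) (t₀ := t₀) (vα := vα) (vβ := vβ) (c := c₀') (s₀ := s₀) (s₁ := s₁) hA hn hm hc₀ hD hw).2.1 rfl
      rw [cv0, cv0] at hr
      change -(z : ℤ) ≤ -1 * (F w 0 - F t 0) ∧ -1 * (F w 0 - F t 0) ≤ P₁.Pp
      constructor <;> linarith [hr.1, hr.2]
  · -- piece `−1`
    intro hτ
    rw [e0]
    rcases LocPrm.dir_eq_or a with hd | hd <;> rw [hd] at hw hτ ⊢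
    · rw [hτ] at hw
      have hr := (coarse_landing_v_one (φ := φ) (t₀ := t₀) (vα := vα) (vβ := vβ) (c := c₀') (s₀ := s₀) (s₁ := s₁) hA hn hm hc₀ hD hw).2.2 rfl
      rw [cv0, cv0] at hr; rw [one_mul]; exact ⟨hm₁.trans hr.1, hr.2.trans hz₂⟩
    · rw [hτ] at hw
      have hr := (coarse_landing_v_neg (φ := φ) (t₀ := t₀) (vα := vα) (vβ := vβ) (c := c₀') (s₀ := s₀) (s₁ := s₁) hA hn hm hc₀ hD hw).2.2 rfl
      rw [cv0, cv0] at hr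
      change -(P₁.Pm : ℤ) ≤ -1 * (F w 0 - F t 0) ∧ -1 * (F w 0 - F t 0) ≤ z
      constructor <;> linarith [hr.1, hr.2]

end VRounds

end Skelφ

end Summit.CriticalPhenomena.PercolationContinuityZ3.Theorems.Transplant

end
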